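import Summits.QuantumFields.BalabanUV.Beta.GAN24.CombBornSector

/-!
# The (III′) born remainder SPLITS BY SECTOR: `combBornOf … cVH cΛ = combBornOf … cVH 0 + combBornOf … 0 cΛ`, and so do its two S-slot letters

NOT IN PRINT — OUR BOOKKEEPING (road-P2 = `b2b-balaban-gan24-p2` gen 56, 2026-08-25; row G-an2-4 ∕ (CONV-C), the (α-0) chain at row D1's literal
OF RECORD (III′) `JsB12CombShSym`; [folklore] composition BY NAME; 0 `def`, 0 cite, 0 `def … : Prop`, 0 `sorry`).  Weight 0.  NEVER «G-an2-4 closed» as (CONV-C);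
NOT D1, NOT BetaPertH, NOT continuum, NOT Clay; NO campaign opened (an2 W-4).

The (III′) twin of leaf-01 g59's (E) `GAN24/BornLambdaLineage` §1 (sector split) for M.50's remainder `combBornOf Lc tabs cE cVH cΛ` over M.51 `CombBornSector`
(generic `d`, any `tabs : SymTables d Lc`, any coefficients; no root quantifier — the comb chart's root is the centred one):
* `combFreshAt_add` — member `j`'s source is its V-source (`cΛ := 0`) plus its Λ-source (`cVH := 0`);
* **`combBornOf_add_sectors`** — `combBornOf Lc tabs cE cVH cΛ k = combBornOf Lc tabs cE cVH 0 k + combBornOf Lc tabs cE 0 cΛ k` (M.51's unrolled form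
  `combBornOf_eq_sum_transport` is additive in its sources on the class of local families: leaf-01's `AffineUnroll.transport_add` with M.51's `isLoc_combStepMap ∕
  combStepMap_add ∕ isLoc_combFreshAt`);
* **`exists_hB_of_sectors`** — the born ROW letter `hB` of M.53 `CombSRowsOfSectors.exists_hS0_ScombOf_of_sectors` from a V-born row letter and a Λ-born row letter
  (constants added, common rate); **`exists_hBd_of_sectors`** — the born RATE letter `hBd` of M.53 `exists_hSall_ScombOf_of_sectors` likewise (`cV + cL`, `max θ`, `min δ`).
So the (III′) born half of the S-slot is the V-born campaign (M.56 `CombBornBorderLineage` is its instance side) plus the Λ-born campaign, exactly as at (E).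
Discharges NOTHING by itself; 0 wall binders.
-/

noncomputable section

open Finset
open scoped BigOperators
open Literature.MathematicalPhysics.QuantumFieldTheory
open Literature.MathematicalPhysics.QuantumFieldTheory.Balaban1983to89
open Literature.MathematicalPhysics.QuantumFieldTheory.Balaban1983to89.Beta
open ExpKernelCalculus (MKer)
open OneStepResolventKernel (Fib LocStencil)
open StepJetData (locStencil_add)
open BalabanStepJets (locStencil_mono)
open Summit.QuantumFields.BalabanUV.Beta.HessKerDressedUnits (unitS)
open Summit.QuantumFields.BalabanUV.Beta.GAN24.CombesThomas (sfStep smStep)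
open Summit.QuantumFields.BalabanUV.Beta.GAN24.StencilSlotOfShapes (unitS_add locStencil_mono')
open Summit.QuantumFields.BalabanUV.Beta.GAN24.AffineUnroll (transport transport_add)
open Summit.QuantumFields.BalabanUV.Beta.SymmetrisedStepJets (SymTables)
open Summit.QuantumFields.BalabanUV.Beta.GAN24.CombWilsonSector (combBornOf)
open Summit.QuantumFields.BalabanUV.Beta.GAN24.CombBornSector (combFreshAt combStepMap isLoc_combStepMap combStepMap_add isLoc_combFreshAt combBornOf_eq_sum_transport)

namespace Summit.QuantumFields.BalabanUV.Beta.GAN24.CombBornSectorSplit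

variable {d : ℕ} {Lc : ℕ} [NeZero Lc] (tabs : SymTables d Lc) (cE cVH cΛ : ℝ)

/-! ## §1 The sources and the remainder split by sector -/

/-- [folklore] **THE SOURCES SPLIT BY SECTOR**: member `j`'s source is its V-source (`cΛ := 0`) plus its Λ-source (`cVH := 0`). -/
theorem combFreshAt_add (j : ℕ) : combFreshAt tabs cVH cΛ j = combFreshAt tabs cVH 0 j + combFreshAt tabs 0 cΛ j := by
  funext κ u
  cases j with
  | zero => simp only [combFreshAt, Pi.add_apply, zero_smul, add_zero, zero_add]
  | succ j => simp only [combFreshAt, Pi.add_apply, zero_mul, zero_smul, add_zero, zero_add]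

/-- NOT IN PRINT; OUR BOOKKEEPING ([folklore]; the (III′) twin of leaf-01's `BornLambdaLineage.bornSecAt_add_sectors`).  **THE (III′) REMAINDER SPLITS BY SECTOR**:
`combBornOf Lc tabs cE cVH cΛ k = combBornOf Lc tabs cE cVH 0 k + combBornOf Lc tabs cE 0 cΛ k` — M.51's unrolled form is additive in its sources on the class of local
stencil families (`AffineUnroll.transport_add` with M.51's `isLoc_combStepMap ∕ combStepMap_add ∕ isLoc_combFreshAt`). -/
theorem combBornOf_add_sectors (k : ℕ) :
    combBornOf Lc tabs cE cVH cΛ k = combBornOf Lc tabs cE cVH 0 k + combBornOf Lc tabs cE 0 cΛ k := by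
  have hadd : ∀ m n j, transport (combStepMap Lc cE) m n (combFreshAt tabs cVH cΛ j)
      = transport (combStepMap Lc cE) m n (combFreshAt tabs cVH 0 j) + transport (combStepMap Lc cE) m n (combFreshAt tabs 0 cΛ j) := by
    intro m n j
    rw [combFreshAt_add]
    exact transport_add (A := combStepMap Lc cE) (P := fun S => ∃ Cs δ : ℝ, 0 < δ ∧ LocStencil S Cs δ)
      (fun j x hx => isLoc_combStepMap cE j hx) (fun j x y hx hy => combStepMap_add cE j hx hy) m n
      (isLoc_combFreshAt tabs cE cVH 0 j) (isLoc_combFreshAt tabs cE 0 cΛ j)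
  rw [combBornOf_eq_sum_transport tabs cE cVH cΛ k, combBornOf_eq_sum_transport tabs cE cVH 0 k, combBornOf_eq_sum_transport tabs cE 0 cΛ k, hadd,
    Finset.sum_congr rfl fun m _ => hadd _ _ _, Finset.sum_add_distrib]
  abel

/-- [folklore] … hence so do its unit tables (`unitS_add`). -/
theorem unitS_combBornOf_add_sectors (n : ℕ) :
    unitS (sfStep Lc n) (smStep d Lc n) (combBornOf Lc tabs cE cVH cΛ n) = fun κ u =>
      unitS (sfStep Lc n) (smStep d Lc n) (combBornOf Lc tabs cE cVH 0 n) κ u + unitS (sfStep Lc n) (smStep d Lc n) (combBornOf Lc tabs cE 0 cΛ n) κ u := by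
  rw [combBornOf_add_sectors tabs cE cVH cΛ n]
  exact unitS_add _ _ _ _

/-! ## §2 The born letters of the S-slot split by sector -/

/-- NOT IN PRINT; OUR BOOKKEEPING ([folklore]; the (III′) twin of `BornLambdaLineage.exists_hB_of_sectors`).  **THE BORN ROW LETTER SPLITS BY SECTOR**: a uniform `LocStencil`
letter for the unit tables of the V-born remainder (`cΛ := 0`) and one for the Λ-born remainder (`cVH := 0`) give the letter `hB` of M.53
`CombSRowsOfSectors.exists_hS0_ScombOf_of_sectors` for the full remainder (constants added, the common rate). -/
theorem exists_hB_of_sectors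
    (hV : ∃ C δ : ℝ, 0 < δ ∧ ∀ j : ℕ, LocStencil (unitS (sfStep Lc j) (smStep d Lc j) (combBornOf Lc tabs cE cVH 0 j)) C δ)
    (hL : ∃ C δ : ℝ, 0 < δ ∧ ∀ j : ℕ, LocStencil (unitS (sfStep Lc j) (smStep d Lc j) (combBornOf Lc tabs cE 0 cΛ j)) C δ) :
    ∃ C δ : ℝ, 0 < δ ∧ ∀ j : ℕ, LocStencil (unitS (sfStep Lc j) (smStep d Lc j) (combBornOf Lc tabs cE cVH cΛ j)) C δ := by
  obtain ⟨CV, δV, hδV, hV⟩ := hV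
  obtain ⟨CL, δL, hδL, hL⟩ := hL
  refine ⟨CV + CL, min δV δL, lt_min hδV hδL, fun j => ?_⟩
  have hCV : 0 ≤ CV := ((hV j) 0 0).nonneg (Sum.inl 0)
  have hCL : 0 ≤ CL := ((hL j) 0 0).nonneg (Sum.inl 0)
  rw [unitS_combBornOf_add_sectors tabs cE cVH cΛ j]
  exact locStencil_add (locStencil_mono (hV j) hCV (min_le_left _ _)) (locStencil_mono (hL j) hCL (min_le_right _ _))

/-- NOT IN PRINT; OUR BOOKKEEPING ([folklore]).  **THE BORN RATE LETTER SPLITS BY SECTOR**: all-scales Cauchy letters for the V-born (`cV·θV^k` at `δV`) and the Λ-born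
(`cL·θL^k` at `δL`) remainders give the letter `hBd` of M.53 `CombSRowsOfSectors.exists_hSall_ScombOf_of_sectors` for the full remainder (`cV + cL`, `max θV θL`, `min δV δL`). -/
theorem exists_hBd_of_sectors
    (hV : ∃ cV θV δV : ℝ, 0 ≤ cV ∧ 0 ≤ θV ∧ θV < 1 ∧ 0 < δV ∧ ∀ k j : ℕ,
      LocStencil (unitS (sfStep Lc (k + j)) (smStep d Lc (k + j)) (combBornOf Lc tabs cE cVH 0 (k + j))
        - unitS (sfStep Lc k) (smStep d Lc k) (combBornOf Lc tabs cE cVH 0 k)) (cV * θV ^ k) δV)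
    (hL : ∃ cL θL δL : ℝ, 0 ≤ cL ∧ 0 ≤ θL ∧ θL < 1 ∧ 0 < δL ∧ ∀ k j : ℕ,
      LocStencil (unitS (sfStep Lc (k + j)) (smStep d Lc (k + j)) (combBornOf Lc tabs cE 0 cΛ (k + j))
        - unitS (sfStep Lc k) (smStep d Lc k) (combBornOf Lc tabs cE 0 cΛ k)) (cL * θL ^ k) δL) :
    ∃ cB θB δB : ℝ, 0 ≤ cB ∧ 0 ≤ θB ∧ θB < 1 ∧ 0 < δB ∧ ∀ k j : ℕ,
      LocStencil (unitS (sfStep Lc (k + j)) (smStep d Lc (k + j)) (combBornOf Lc tabs cE cVH cΛ (k + j))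
        - unitS (sfStep Lc k) (smStep d Lc k) (combBornOf Lc tabs cE cVH cΛ k)) (cB * θB ^ k) δB := by
  obtain ⟨cV, θV, δV, hcV, hθV0, hθV1, hδV, hV⟩ := hV
  obtain ⟨cL, θL, δL, hcL, hθL0, hθL1, hδL, hL⟩ := hL
  set θ : ℝ := max θV θL with hθ
  have hθ0 : 0 ≤ θ := le_max_of_le_left hθV0
  have hθ1 : θ < 1 := max_lt hθV1 hθL1
  refine ⟨cV + cL, θ, min δV δL, by positivity, hθ0, hθ1, lt_min hδV hδL, fun k j => ?_⟩
  have e2 : unitS (sfStep Lc (k + j)) (smStep d Lc (k + j)) (combBornOf Lc tabs cE cVH cΛ (k + j))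
        - unitS (sfStep Lc k) (smStep d Lc k) (combBornOf Lc tabs cE cVH cΛ k)
      = fun κ u => (unitS (sfStep Lc (k + j)) (smStep d Lc (k + j)) (combBornOf Lc tabs cE cVH 0 (k + j))
          - unitS (sfStep Lc k) (smStep d Lc k) (combBornOf Lc tabs cE cVH 0 k)) κ u
        + (unitS (sfStep Lc (k + j)) (smStep d Lc (k + j)) (combBornOf Lc tabs cE 0 cΛ (k + j))
          - unitS (sfStep Lc k) (smStep d Lc k) (combBornOf Lc tabs cE 0 cΛ k)) κ u := by
    rw [unitS_combBornOf_add_sectors tabs cE cVH cΛ (k + j), unitS_combBornOf_add_sectors tabs cE cVH cΛ k]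
    funext κ u x y a b
    simp only [Pi.sub_apply, Pi.add_apply]
    ring
  rw [e2, add_mul]
  refine locStencil_add ?_ ?_
  · exact locStencil_mono' (hV k j) (mul_le_mul_of_nonneg_left (pow_le_pow_left₀ hθV0 (le_max_left _ _) k) hcV) (min_le_left _ _)
  · exact locStencil_mono' (hL k j) (mul_le_mul_of_nonneg_left (pow_le_pow_left₀ hθL0 (le_max_right _ _) k) hcL) (min_le_right _ _)

end Summit.QuantumFields.BalabanUV.Beta.GAN24.CombBornSectorSplit

end
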